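/-
COR-CM (cells pub-hodgecm / pub-hodgecm2, stage 2 of the Hodge ladder) — TRANSPOSITION SURGE, item (vi) sub-binder S2, CM side.
Seat prover-pub-hodgecm2-pin-2-g14-0 = PINNING BUILDER 2 of 3 (hMatch / hCM), CM owner of record of `hCMisogE`; the post-port half of the
X2 residual R2 (HM-DELTA2-CLARITY §6; own-b01 RECIPE v1.3 row 11 «X2b», admissibility half).  Theorems only: no definition, no instance, no named fact, nothing asserted, no proof holes (the identification of the two
presentations of the reflex field is Mathlib's `IntermediateField.equivOfEq`, written out at each use).  FRAMING: HC_CM is NOT proved; hM is NOT signed equal; this file is NOT «Δ2 BRIDGE CLOSED».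
-/
import Summits.HodgeConjecture.HodgeCM.Model.Binders.JLiuCornerOfReflex
import Summits.HodgeConjecture.HodgeCM.Model.LiuCMSideOfReflex
import Summits.HodgeConjecture.HodgeCM.PerL34.ThetaSubOfLiu_1
import Summits.HodgeConjecture.CorCM.B01.Transposition.Item6PinMatchReflexPair
import Literature.NumberTheory.ComplexMultiplication.InducedCMType
import HarnessLib

/-!
# Item (vi) S2, CM side — X2 residual R2, the PACKAGE-TOKEN half (post-port)

The tree-side transport kit `Transposition/Item6PinMatchReflexPair.lean` (✔ p312165) proved, in tree vocabulary only, the three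
sentences that make the package admissibility predicate of the ported model
`HodgeCM.Model.LiuCMSide.IsReflexOfType ι₁ d Φ := d.IsReflexOf ι₁ (autSet ι₁ Φ)` (port layer L45
`Summits/HodgeConjecture/HodgeCM/Model/Binders/JLiuCornerOfReflex.lean`, package bodies `autImage` / `reflexFieldOf` / `reflexTypeC` /
`IsReflexOf` / `autSet` / `IsReflexOfType`) a definitional unfolding of «`d` presents the TREE reflex pair
`(K* := ↥(reflexField ℚ L (algValuedIn ι₁ Φ.1)), Φ* := (reflexCMType ι₁ Φ id).1)`» ([Shimura1998 §8.3 Prop. 28]; [Liu2021] Def. 4.3 (2):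
`(M'_μ, Ψ_μ)` = the reflex of `(E, Φ_μ)`).  Now that the port layer is in the tree, THIS FILE writes the identification with the
package tokens themselves:
* §0 carrier: the package's `HodgeCM.CMTypeOps.inflate` IS the tree's `inducedCMType` (same body; `rfl`);
* §1 `autImage (autSet ι₁ Φ) = algValuedIn ι₁ Φ.1`, `reflexFieldOf (autSet ι₁ Φ) = reflexField ℚ L (algValuedIn ι₁ Φ.1)`, and the
  canonical `ε₀ := IntermediateField.equivOfEq (reflexFieldOf_autSet_eq ι₁ Φ) : K*_pkg ≃ₐ[ℚ] K*_tree` (the identity on elements of `L`, written out at each use);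
* §2 `ψ ∈ reflexTypeC ι₁ (autSet ι₁ Φ) ↔ ψ ∘ ε₀⁻¹ ∈ (reflexCMType ι₁ Φ id).1` (both directions) and the set identity
  `reflexTypeC ι₁ (autSet ι₁ Φ) = (inducedCMType ε₀⁻¹ (reflexCMType ι₁ Φ id)).1`;
* §3 **R2**: `d.IsReflexOfType ι₁ Φ ↔ ∃ e : d.K' ≃+* K*_tree, d.τ ∘ d.k = ι₁ ∘ incl_{K*} ∘ e ∧ ∀ ψ, ψ ∈ d.Φ' ↔ ψ ∘ e⁻¹ ∈ (reflexCMType ι₁ Φ id).1`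
  — the package's admissibility predicate IS «reflex side of the tree pair» (the admissibility half of RECIPE v1.3 row 11; the record
  half — Liu's datum `(A_μ ⊗_{E,ι₁} ℂ, α)` as a `LiuCMSide` — is the X1-class construction, not written here);
* §4 (port layer L68 `HodgeCM/Model/LiuCMSideOfReflex.lean`): the package's reflex CM type `LiuCMSide.reflexCMType ι₁ Φ` EQUALS
  `inducedCMType ε₀⁻¹ (reflexCMType ι₁ Φ id)` and its inflation `LiuCMSide.reflexTypeInflate ι₁ Φ` (= the CM type `ΦA` of the package's
  admissible record `LiuCMSide.ofReflex ι₁ hCM Φ`, `ofReflex_ΦA`) EQUALS `inducedCMType incl_{K*} (reflexCMType ι₁ Φ id)` — the shape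
  `Ψ̃ = inducedCMType e (reflexCMType ι₁ Φ id)` of the tree CM side (`Item6PinMatch.lean` §1).

Nothing here touches a binder, a count or the pointer; no package statement is restated (the package declarations are IMPORTED).

References: G. Shimura, *Abelian Varieties with Complex Multiplication and Modular Functions* (1998) §8.3 Prop. 28; Y. Liu,
*Fourier–Jacobi cycles and arithmetic relative trace formula*, Camb. J. Math. 9 (2021) = arXiv:2102.11518, Def. 4.3 (2)
(`FJcycle.tex` l. 1914–1921).
-/

set_option autoImplicit false

noncomputable section

open scoped Pointwise

namespace Summit.HodgeConjecture.CorCM.Transposition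

open NumberField
open Literature.AlgebraicGeometry.Motives (CMType)
open Literature.NumberTheory.ComplexMultiplication
open HodgeCM.Model (LiuCMSide)
open HodgeCM.Model.LiuCMSide (autImage reflexFieldOf reflexTypeC autSet)

variable {L : HodgeCM.CMField} (ι₁ : L →+* ℂ) (Φ : CMType L)

/-! ### §0 Carrier: the package's `inflate` IS the tree's `inducedCMType` (both bodies `{τ | τ ∘ k ∈ Φ}`) -/

/-- **Carrier identity** (X3-type, definitional): `HodgeCM.CMTypeOps.inflate k Ψ = inducedCMType k Ψ`. [folklore] -/
theorem inflate_eq_inducedCMType {K M : Type*} [Field K] [Field M] (k : K →+* M) (Ψ : CMType K) :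
    HodgeCM.CMTypeOps.inflate k Ψ = inducedCMType k Ψ := rfl

/-! ### §1 The index set and the reflex field: package tokens = tree objects -/

/-- **(F) post-port**: the package index set `autImage (autSet ι₁ Φ)` IS the tree's `algValuedIn ι₁ Φ`. [folklore] -/
theorem autImage_autSet_eq_algValuedIn : autImage (autSet ι₁ Φ) = algValuedIn ι₁ Φ.1 :=
  image_coe_setOf_comp_mem_eq_algValuedIn ι₁ Φ

/-- Hence the package reflex field `reflexFieldOf (autSet ι₁ Φ)` IS the tree's `K* = reflexField ℚ L (algValuedIn ι₁ Φ)`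
([Liu2021] Def. 4.3: `M'_μ`). [folklore] -/
theorem reflexFieldOf_autSet_eq : reflexFieldOf (autSet ι₁ Φ) = reflexField ℚ L (algValuedIn ι₁ Φ.1) :=
  congrArg (reflexField ℚ L) (autImage_autSet_eq_algValuedIn ι₁ Φ)

/-- Clause (i) of `IsReflexOf`, post-port: `ι₁ ∘ incl_pkg ∘ ε₀⁻¹ = ι₁ ∘ incl_tree`. [folklore] -/
theorem comp_algebraMap_comp_equivOfEq_reflexFieldOf_symm :
    (ι₁.comp (algebraMap (↥(reflexFieldOf (autSet ι₁ Φ))) L)).comp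
        ((IntermediateField.equivOfEq (reflexFieldOf_autSet_eq ι₁ Φ)).symm : ↥(reflexField ℚ L (algValuedIn ι₁ Φ.1)) →+* ↥(reflexFieldOf (autSet ι₁ Φ))) =
      ι₁.comp (algebraMap (↥(reflexField ℚ L (algValuedIn ι₁ Φ.1))) L) :=
  comp_algebraMap_comp_equivOfEq_symm ι₁ Φ (autImage_autSet_eq_algValuedIn ι₁ Φ)

/-! ### §2 The reflex type: package `reflexTypeC ι₁ (autSet ι₁ Φ)` = tree `reflexCMType ι₁ Φ id` along `ε₀` -/

variable [IsGalois ℚ L]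

/-- **(T) post-port**: a complex embedding `τ` of the tree reflex field `K*` lies in the tree reflex type
`(reflexCMType ι₁ Φ id).1` iff `τ ∘ ε₀` lies in the package reflex type `reflexTypeC ι₁ (autSet ι₁ Φ)`.
[cite: Shimura1998, §8.3 Prop. 28] -/
theorem mem_reflexCMType_id_iff_comp_equivOfEq_mem_reflexTypeC
    (τ : ↥(reflexField ℚ L (algValuedIn ι₁ Φ.1)) →+* ℂ) :
    τ ∈ (reflexCMType ι₁ Φ (AlgHom.id ℚ L)).1 ↔
      τ.comp (IntermediateField.equivOfEq (reflexFieldOf_autSet_eq ι₁ Φ) : ↥(reflexFieldOf (autSet ι₁ Φ)) →+* ↥(reflexField ℚ L (algValuedIn ι₁ Φ.1))) ∈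
        reflexTypeC ι₁ (autSet ι₁ Φ) :=
  mem_reflexCMType_id_iff_exists_mem_reflexLift_of_eq ι₁ Φ (autImage_autSet_eq_algValuedIn ι₁ Φ) τ

/-- **(T) post-port, package side first**: `ψ ∈ reflexTypeC ι₁ (autSet ι₁ Φ) ↔ ψ ∘ ε₀⁻¹ ∈ (reflexCMType ι₁ Φ id).1`.
[cite: Shimura1998, §8.3 Prop. 28] -/
theorem mem_reflexTypeC_autSet_iff (ψ : ↥(reflexFieldOf (autSet ι₁ Φ)) →+* ℂ) :
    ψ ∈ reflexTypeC ι₁ (autSet ι₁ Φ) ↔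
      ψ.comp ((IntermediateField.equivOfEq (reflexFieldOf_autSet_eq ι₁ Φ)).symm :
          ↥(reflexField ℚ L (algValuedIn ι₁ Φ.1)) →+* ↥(reflexFieldOf (autSet ι₁ Φ))) ∈
        (reflexCMType ι₁ Φ (AlgHom.id ℚ L)).1 := by
  rw [mem_reflexCMType_id_iff_comp_equivOfEq_mem_reflexTypeC]
  refine Iff.of_eq (congrArg (fun χ => χ ∈ reflexTypeC ι₁ (autSet ι₁ Φ)) ?_)
  exact RingHom.ext fun x => congrArg ψ (Subtype.ext rfl)

/-- **(T) as a set identity**: the package reflex type IS the tree reflex type induced along `ε₀⁻¹ : K*_tree ≃ K*_pkg`.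
[cite: Shimura1998, §8.3 Prop. 28] -/
theorem reflexTypeC_autSet_eq_inducedCMType_val :
    reflexTypeC ι₁ (autSet ι₁ Φ) =
      (inducedCMType ((IntermediateField.equivOfEq (reflexFieldOf_autSet_eq ι₁ Φ)).symm :
          ↥(reflexField ℚ L (algValuedIn ι₁ Φ.1)) →+* ↥(reflexFieldOf (autSet ι₁ Φ)))
        (reflexCMType ι₁ Φ (AlgHom.id ℚ L))).1 :=
  Set.ext fun ψ => mem_reflexTypeC_autSet_iff ι₁ Φ ψ

/-! ### §3 R2 — the admissibility predicate: package `IsReflexOfType` ↔ «reflex side of the TREE pair» -/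

/-- **R2 (post-port), tree ⇒ package.**  A CM record `d` presenting an isomorphic copy `e : d.K' ≃ K*` of the TREE reflex
pair — `d.τ ∘ d.k = ι₁ ∘ incl_{K*} ∘ e` and `d.Φ' = e^*(reflexCMType ι₁ Φ id)` — is ADMISSIBLE for `Φ` in the package sense
`d.IsReflexOfType ι₁ Φ` ([Liu2021] Def. 4.3 (2): `(M'_μ, Ψ_μ)` = the reflex of `(E, Φ_μ)`). [cite: Shimura1998, §8.3 Prop. 28] -/
theorem isReflexOfType_of_reflexCMType (d : LiuCMSide)
    (e : d.K' ≃+* ↥(reflexField ℚ L (algValuedIn ι₁ Φ.1)))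
    (hτ : d.τ.comp d.k = (ι₁.comp (algebraMap (↥(reflexField ℚ L (algValuedIn ι₁ Φ.1))) L)).comp e.toRingHom)
    (hΦ : ∀ ψ : d.K' →+* ℂ, ψ ∈ d.Φ' ↔ ψ.comp e.symm.toRingHom ∈ (reflexCMType ι₁ Φ (AlgHom.id ℚ L)).1) :
    d.IsReflexOfType ι₁ Φ := by
  refine ⟨e.trans (IntermediateField.equivOfEq (reflexFieldOf_autSet_eq ι₁ Φ)).symm.toRingEquiv, ?_, fun ψ => ?_⟩
  · rw [hτ, ← comp_algebraMap_comp_equivOfEq_reflexFieldOf_symm ι₁ Φ]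
    exact RingHom.ext fun _ => rfl
  · rw [hΦ ψ, mem_reflexCMType_id_iff_comp_equivOfEq_mem_reflexTypeC]
    refine Iff.of_eq (congrArg (fun χ => χ ∈ reflexTypeC ι₁ (autSet ι₁ Φ)) ?_)
    exact RingHom.ext fun _ => rfl

/-- **R2 (post-port), package ⇒ tree.**  Conversely an admissible record presents an isomorphic copy of the TREE reflex pair.
[cite: Shimura1998, §8.3 Prop. 28] -/
theorem exists_equiv_reflexCMType_of_isReflexOfType (d : LiuCMSide) (h : d.IsReflexOfType ι₁ Φ) :
    ∃ e : d.K' ≃+* ↥(reflexField ℚ L (algValuedIn ι₁ Φ.1)),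
      d.τ.comp d.k = (ι₁.comp (algebraMap (↥(reflexField ℚ L (algValuedIn ι₁ Φ.1))) L)).comp e.toRingHom ∧
      ∀ ψ : d.K' →+* ℂ, ψ ∈ d.Φ' ↔ ψ.comp e.symm.toRingHom ∈ (reflexCMType ι₁ Φ (AlgHom.id ℚ L)).1 := by
  obtain ⟨ε, hτ, hΦ⟩ := h
  refine ⟨ε.trans (IntermediateField.equivOfEq (reflexFieldOf_autSet_eq ι₁ Φ)).toRingEquiv, ?_, fun ψ => ?_⟩
  · rw [hτ]
    exact RingHom.ext fun _ => rfl
  · rw [hΦ ψ, mem_reflexTypeC_autSet_iff]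
    refine Iff.of_eq (congrArg (fun χ => χ ∈ (reflexCMType ι₁ Φ (AlgHom.id ℚ L)).1) ?_)
    exact RingHom.ext fun _ => rfl

/-- **R2 as an `iff`.** [cite: Shimura1998, §8.3 Prop. 28] -/
theorem isReflexOfType_iff_exists_equiv_reflexCMType (d : LiuCMSide) :
    d.IsReflexOfType ι₁ Φ ↔
      ∃ e : d.K' ≃+* ↥(reflexField ℚ L (algValuedIn ι₁ Φ.1)),
        d.τ.comp d.k = (ι₁.comp (algebraMap (↥(reflexField ℚ L (algValuedIn ι₁ Φ.1))) L)).comp e.toRingHom ∧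
        ∀ ψ : d.K' →+* ℂ, ψ ∈ d.Φ' ↔ ψ.comp e.symm.toRingHom ∈ (reflexCMType ι₁ Φ (AlgHom.id ℚ L)).1 :=
  ⟨exists_equiv_reflexCMType_of_isReflexOfType ι₁ Φ d, fun ⟨e, hτ, hΦ⟩ => isReflexOfType_of_reflexCMType ι₁ Φ d e hτ hΦ⟩

/-! ### §4 (port layer L68 `LiuCMSideOfReflex`) the package's reflex CM type and its inflation, as tree objects -/

/-- **The package reflex CM type `Ψ_Φ` IS the tree's `reflexCMType ι₁ Φ id` induced along `ε₀⁻¹`** (equality of `CMType`s of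
the package reflex field). [cite: Shimura1998, §8.3 Prop. 28] -/
theorem liuCMSide_reflexCMType_eq_inducedCMType :
    HodgeCM.Model.LiuCMSide.reflexCMType ι₁ Φ =
      inducedCMType ((IntermediateField.equivOfEq (reflexFieldOf_autSet_eq ι₁ Φ)).symm :
          ↥(reflexField ℚ L (algValuedIn ι₁ Φ.1)) →+* ↥(reflexFieldOf (autSet ι₁ Φ)))
        (reflexCMType ι₁ Φ (AlgHom.id ℚ L)) :=
  Subtype.ext (reflexTypeC_autSet_eq_inducedCMType_val ι₁ Φ)

/-- **The package's inflated reflex type `(Ψ_Φ)^L` IS the tree's induced type `inducedCMType incl_{K*} (reflexCMType ι₁ Φ id)`**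
— the shape `Ψ̃ = inducedCMType e (reflexCMType ι₁ Φ id)` of the tree CM side (`Item6PinMatch.lean` §1, at `M := L`,
`e := incl`); this is the CM type `ΦA` of the package's admissible record `LiuCMSide.ofReflex ι₁ hCM Φ` (`ofReflex_ΦA`).
[cite: Shimura1998, §8.3 Prop. 28] -/
theorem liuCMSide_reflexTypeInflate_eq_inducedCMType :
    HodgeCM.Model.LiuCMSide.reflexTypeInflate ι₁ Φ =
      inducedCMType (algebraMap (↥(reflexField ℚ L (algValuedIn ι₁ Φ.1))) L) (reflexCMType ι₁ Φ (AlgHom.id ℚ L)) := by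
  refine Subtype.ext (Set.ext fun τ => ?_)
  show τ ∈ (HodgeCM.CMTypeOps.inflate _ (HodgeCM.Model.LiuCMSide.reflexCMType ι₁ Φ)).1 ↔ _
  rw [liuCMSide_reflexCMType_eq_inducedCMType, inflate_eq_inducedCMType, mem_inducedCMType_iff, mem_inducedCMType_iff,
    mem_inducedCMType_iff]
  exact Iff.rfl

end Summit.HodgeConjecture.CorCM.Transposition

end
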